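import Mathlib
import HarnessLib
import Literature.MathematicalPhysics.QuantumFieldTheory.Balaban1983to89.B10SectCExpansion

/-!
# `Balaban1983to89.B10Eq57Resummation` — [Balaban1985UV3] p. 270, the sentence after **(57)**: *"We sum up all the
# coefficients at the same monomial in A. We get a coefficient which, by bound similar to (45), (46), can be estimated
# as in (56) (with O(g_k^m))."* — the resummation (57) ⇒ (56) PROVED as d = 3 power counting over the typed shapes
# `B10SectCExpansion.Bound57` / `B10SectCExpansion.Bound56Resummed`

T. Bałaban, *Ultraviolet stability of three-dimensional lattice pure gauge field theories*, Commun. Math. Phys. **102**,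
255–275 (1985) [Balaban1985UV3] (cell paper B10; held `paper:balaban1985-cmp102-uv-stability-3d`; journal page =
PDF page + 254).  The quotations below were READ AS IMAGES on the renders
`run/shared/lean/pub/pub-balaban/b2b-balaban-ref1/pages/1985-cmp102-uv-stability-3d/…-p012-x2.png` (p. 266),
`…-p013-x2.png` (p. 267), `…-p015-x2.png` (p. 269), `…-p016-x2.png` (p. 270), 2026-08-21.

HONEST FRAMING (mega-formalization `lit-balaban`, verbatim): statement-level skeleton of published theorems with
citation tags; proofs where landed; nothing here is a claim about the Yang–Mills mass gap.

WHAT IS PRINTED (verbatim).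
* p. 266, (43): *"Y_j = (y, c₁, …, c_n), where y represents big blocks of L^jη-lattice, contained in Ω_k, i.e.
  y ∈ Ω_k^{(j)} ∩ M₁L^jηZ³, and c_i are bonds in Ω_k^{(j)}, |c_{i,−} − y| < R(g_j)M₁L^jη, 𝒫_j(Y_j, U_k) = ⟨𝒫_j(Y_j),
  B_k(c₁), …, B_k(c_n)⟩, n ≥ 2"*; p. 267: *"Of course the condition n ≥ 2 plays a crucial role. … Summation over y
  gives the factor (M₁L^jη)^{−3}|Λ_k|, and finally summation over j = 1, …, k gives"* (46), *"Because n ≥ 2, so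
  L^{−2n} ≤ L^{−4} and the functions 𝒫_j(Y_j, U_k) behave like irrelevant variables in the dimensions 3"*.
* p. 269–270, (56): *"Σ_{b₁,…,b_m ⊂ B(Λ_{k+1})} ⟨v(g_k, b₁, …, b_m), A(b₁), …, A(b_m)⟩, m ≥ 3, (56) and |v(g_k, b₁, …, b_m)| ≤
  O(g_k^{m−2}) exp(−½δ₀𝓛({b_i})) (let us recall that 𝓛({b_i}) denotes the length of a shortest graph on the unit
  lattice, connecting points of b_i and possibly other points)."*
* p. 270: *"For lower order terms we expand the function into powers of g_kA, and we estimate terms with an overall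
  power greater than six as above. Lower order terms have again the form of non-local polynomials (56), but now a
  coefficient v connected with the expansion of 𝒫_j(Y_j, U_k) has the estimate |v(g_k, b₁, …, b_m)| ≤ O(g_k^m){Π_{i=1}^n
  O(1) exp(−½κ₁(M₁L^jη)^{−1}|c_{i,−} − y|) × (L^jη)^{−1}|c_{i,−} − y|(L^jη)²} exp(−½δ₀𝓛({b_i} ∪ {y})). (57)
  We sum up all the coefficients at the same monomial in A. We get a coefficient which, by bound similar to (45),
  (46), can be estimated as in (56) (with O(g_k^m)). Thus these expansions and resummations give a non-local
  polynomial 𝒱(A), whose terms are described by (56). The integral on the right-hand side of (55) is estimated by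
  exp[Σ_{j=1}^k Σ_{Y_j} 𝒫_j(Y_j, U_{k+1}) + (the constants in (41))] × ∫dμ_{C^{(k)}}(A)χ exp[𝒱(A) + O((L^kε)^{3+κ₀})|T₁^{(k)}|].
  (58)"* — the A-independent parts `𝒫_j(Y_j, U_{k+1})` (degree `m = 0`) stay OUTSIDE the integral; `𝒱(A)` collects
  `m ≥ 1`.

WHY THIS FILE EXISTS (unit `lit-balaban-r07`, reader/typer and fold owner of B10, gen 8).  SKELETON rows B10.Eq57 and
B10.Eq56 are typed (`B10SectCExpansion.Bound57`, `.Bound56`, `.Bound56Resummed`, p238811, this seat gen 1) as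
hypothesis-shaped leaves; the printed inference between them — the resummation over the previous-scale terms
`Y_j = (y, c₁, …, c_n)` *"by bound similar to (45), (46)"* — is the d = 3 power counting this seat proved for
(44) ⇒ (45) ⇒ (46) (`B10SectCExpansion.bound45_of_bound44`, `.bound46_of_bound45`, gen 2), now with the tree-decay
factor `exp(−½δ₀𝓛({b_i} ∪ {y}))` carried along.  This file PROVES it, with every constant explicit and the two facts
about `𝓛` and the two lattice sums it uses displayed as hypotheses.

THE ARGUMENT (kernel-checked below; `ℓ_j = L^jη = L^{j−k}`, `s_j(y) = Σ_{c admissible} leg_j(y, c)` the one-leg sum of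
(57)'s braces).  Fix a monomial `b = (b₁, …, b_m)`, `m ≥ 1`.  (1) For one term `Y_j`: (57).  (2) Sum over the legs
`c₁, …, c_n` at fixed `(j, y, n)`: distributivity, `Σ_c Π_i leg(c_i) = s_j(y)ⁿ` (as in (44) ⇒ (45)).  (3) Degree floor
`n ≥ 2` of (43) and `s_j(y) ≤ S₀ℓ_j²` with `S₀ = O(1)·Z` SCALE-FREE (`Z` = the one-leg lattice sum
`Σ_c exp(−½κ₁(M₁ℓ_j)^{−1}|c₋ − y|)(ℓ_j^{−1}|c₋ − y|)`, print's `O(M₁³)`-type number; `ℓ_j ≤ 1`): `Σ_{2≤n≤N} s_j(y)ⁿ ≤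
ℓ_j⁴·Σ_{2≤n≤N} S₀ⁿ` — *"L^{−2n} ≤ L^{−4}"* (no smallness of `S₀` is needed at finite expansion order `N`; the printed
O(1) depends on `N`).  (4) Tree geometry: `𝓛({b_i} ∪ {y}) ≥ 𝓛({b_i})` and `𝓛({b_i} ∪ {y}) ≥ |b_{1,−} − y|` (a
connected graph through all these points is at least that long), hence `exp(−½δ₀𝓛({b_i} ∪ {y})) ≤
exp(−¼δ₀𝓛({b_i}))·exp(−¼δ₀|b_{1,−} − y|)`.  (5) Sum over the blocks `y` of the `M₁ℓ_j`-lattice: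
`Σ_y exp(−¼δ₀|b_{1,−} − y|) ≤ K(M₁ℓ_j)^{−3}` — *"Summation over y gives the factor (M₁L^jη)^{−3}"*.  (6) Sum over
scales: `Σ_{j=1}^k ℓ_j⁴(M₁ℓ_j)^{−3} = M₁^{−3}Σ_j L^{j−k} ≤ M₁^{−3}L/(L − 1)` (`B10.powerCounting_d3`).  Result: the resummed
coefficient obeys **`|W(g_k, b₁, …, b_m)| ≤ C⋆·g_k^m·exp(−¼δ₀𝓛({b_i}))`**, `C⋆ = C·(Σ_{2≤n≤N}(C′Z)ⁿ)·K·M₁^{−3}·L/(L − 1)` —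
the shape (56) *"with O(g_k^m)"*, i.e. `Bound56Resummed X W g_k (δ₀/2) C⋆`: the printed claim holds with the tree-decay
RATE HALVED (`½δ₀ ↦ ¼δ₀`; print's "as in (56)" does not track the rate — recorded, not an objection: (56)'s `δ₀` is
itself an unspecified fraction of the propagator decay).

WHAT THIS FILE PROVES (kernel, no `sorry`, axioms standard; three real-valued bookkeeping definitions (`leg57`,
`geomTail`, `resum`), theorems otherwise; NO `Prop` definition, NO new named fact).
`bound57_iff_leg` ((57) in terms of `leg57`), `leg57_nonneg`, `sum_leg57_le` (`s_j(y) ≤ C′Zℓ_j²`), `legSum_pow_le`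
(step 3, one degree), `degreeSum57_le` (step 2), `nSum57_le` (steps 2–3: `Σ_{n≤N}Σ_c|w| ≤ C g^m ℓ_j⁴ G e^{−½δ₀𝓛(b∪y)}`),
`treeFactor_split` (step 4), `blockSum57_le` (step 5), `scaleSum_le` (step 6), and the theorem
**`bound56Resummed_of_bound57`** (steps 1–6: `Bound57` for every previous-scale term ⇒ `Bound56Resummed` for the
resummed family `resum`, constant `C⋆` explicit), with `resum_zero` (degree 0 is empty: those terms are the
`𝒫_j(Y_j, U_{k+1})` kept outside the integral in (58)).

SCOPE, stated honestly.  Over the abstract geometry carrier `B10SectCExpansion.VertexGeometry` (only NAMES: bonds,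
sites, `𝓛`, `c₋`, `|·−·|`), exactly as the typed rows; the two properties of the printed `𝓛` used in step 4
(monotonicity under adding the point `y`; domination of the distance from a point of `b₁` to `y`) and the two lattice
sums of steps 3 and 5 (print: *"similar to (45), (46)"*; their values `Z = O(M₁³)`-type and `K = O(δ₀^{−3})`-type are
NOT re-derived — cell census C-B10-1 for (45)) are HYPOTHESES, as are the degree floor `n ≥ 2` of (43), the absence of
degree-0 coefficients (kept outside the integral by (58)) and the finite expansion order `N`.  Nothing of the series is
constructed; value = the printed one-sentence inference made a kernel theorem with explicit constants; NOT summit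
progress.
-/

noncomputable section

namespace Literature.MathematicalPhysics.QuantumFieldTheory.Balaban1983to89.B10Eq57Resummation

open Finset
open Literature.MathematicalPhysics.QuantumFieldTheory.Balaban1983to89
open Literature.MathematicalPhysics.QuantumFieldTheory.Balaban1983to89.B10SectCExpansion

variable (X : VertexGeometry)

/-! ## §1 The objects: the leg factor of (57), the degree tail, the resummed coefficients -/

/-- One LEG FACTOR of (57)'s braces: `O(1) exp(−½κ₁(M₁L^jη)^{−1}|c₋ − y|)·(L^jη)^{−1}|c₋ − y|·(L^jη)²` with `O(1) = C′`,
`ℓ = L^jη`. [cite: Balaban1985UV3, (57) p.270] -/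
def leg57 (κ₁ M₁ ℓ C' : ℝ) (y : X.Site) (c : X.Bond) : ℝ :=
  C' * Real.exp (-(κ₁ / 2) * (M₁ * ℓ)⁻¹ * X.dist (X.cminus c) y) * ((ℓ⁻¹ * X.dist (X.cminus c) y) * ℓ ^ 2)

/-- The degree tail `Σ_{2 ≤ n ≤ N} S₀ⁿ` (finite expansion order `N`; p. 270: *"we expand the function into powers of
g_kA, and we estimate terms with an overall power greater than six as above"*). [cite: Balaban1985UV3, p.270 (after (57))] -/
def geomTail (S₀ : ℝ) (N : ℕ) : ℝ := ∑ n ∈ Ico 2 (N + 1), S₀ ^ n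

/-- *"We sum up all the coefficients at the same monomial in A"* (p. 270): the RESUMMED coefficient family — over the
scales `j = 1, …, k`, the blocks `y ∈ blocks j` of the `M₁L^jη`-lattice, the degrees `n ≤ N` and the admissible legs
`c : Fin n → adm j y` ((43): `|c_{i,−} − y| < R(g_j)M₁L^jη`) — of the coefficient families `w j y n c` (sizes of the
coefficients `v` of the expansion of `𝒫_j(Y_j, U_k)`, `Y_j = (y, c)`). [cite: Balaban1985UV3, p.270 (after (57))] -/
def resum (k N : ℕ) (blocks : ℕ → Finset X.Site) (adm : ℕ → X.Site → Finset X.Bond)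
    (w : ℕ → X.Site → (n : ℕ) → (Fin n → X.Bond) → CoeffSizes X) : CoeffSizes X :=
  fun m b => ∑ j ∈ Icc 1 k, ∑ y ∈ blocks j, ∑ n ∈ range (N + 1),
    ∑ c ∈ Fintype.piFinset (fun _ : Fin n => adm j y), w j y n c m b

variable {X}

/-- (57) read through `leg57` (definitional). [cite: Balaban1985UV3, (57) p.270] -/
theorem bound57_iff_leg (w : CoeffSizes X) (gk κ₁ δ₀ M₁ ℓ C C' : ℝ) (y : X.Site) {n : ℕ}
    (c : Fin n → X.Bond) :
    Bound57 X w gk κ₁ δ₀ M₁ ℓ C C' y c ↔ ∀ (m : ℕ) (b : Fin m → X.Bond),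
      |w m b| ≤ C * gk ^ m * (∏ i, leg57 X κ₁ M₁ ℓ C' y (c i)) *
        Real.exp (-(δ₀ / 2) * X.treeLen (Set.range b) {y}) :=
  Iff.rfl

/-- The leg factors are non-negative (`C′ ≥ 0`, `ℓ ≥ 0`, distances `≥ 0`). [cite: Balaban1985UV3, (57) p.270] -/
theorem leg57_nonneg {κ₁ M₁ ℓ C' : ℝ} (hC' : 0 ≤ C') (hℓ : 0 ≤ ℓ) (hdist : ∀ x y, 0 ≤ X.dist x y)
    (y : X.Site) (c : X.Bond) : 0 ≤ leg57 X κ₁ M₁ ℓ C' y c := by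
  unfold leg57
  have h1 : 0 ≤ ℓ⁻¹ * X.dist (X.cminus c) y := mul_nonneg (inv_nonneg.2 hℓ) (hdist _ _)
  exact mul_nonneg (mul_nonneg hC' (Real.exp_pos _).le) (mul_nonneg h1 (sq_nonneg ℓ))

/-- **Step 3a — the one-leg sum is `O(1)·Z·ℓ²`**: with `Z` a bound of the scale-free lattice sum
`Σ_{c admissible} exp(−½κ₁(M₁ℓ)^{−1}|c₋ − y|)·(ℓ^{−1}|c₋ − y|)` (print's `O(M₁³)`-type number of (45)),
`s(y) = Σ_c leg(c) ≤ C′Zℓ²` — the two powers of `ℓ = L^jη` per leg that drive the power counting.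
[cite: Balaban1985UV3, (45) p.267, (57) p.270] -/
theorem sum_leg57_le {κ₁ M₁ ℓ C' Z : ℝ} (hC' : 0 ≤ C') (adm : Finset X.Bond) (y : X.Site)
    (hZ : ∑ c ∈ adm, Real.exp (-(κ₁ / 2) * (M₁ * ℓ)⁻¹ * X.dist (X.cminus c) y) * (ℓ⁻¹ * X.dist (X.cminus c) y) ≤ Z) :
    ∑ c ∈ adm, leg57 X κ₁ M₁ ℓ C' y c ≤ C' * Z * ℓ ^ 2 := by
  have hre : ∑ c ∈ adm, leg57 X κ₁ M₁ ℓ C' y c = (C' * ℓ ^ 2) *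
      ∑ c ∈ adm, Real.exp (-(κ₁ / 2) * (M₁ * ℓ)⁻¹ * X.dist (X.cminus c) y) * (ℓ⁻¹ * X.dist (X.cminus c) y) := by
    rw [mul_sum]
    exact sum_congr rfl (fun c _ => by unfold leg57; ring)
  rw [hre]
  calc (C' * ℓ ^ 2) * _ ≤ (C' * ℓ ^ 2) * Z := mul_le_mul_of_nonneg_left hZ (by positivity)
    _ = C' * Z * ℓ ^ 2 := by ring

/-! ## §2 Steps 2–3: the sums over the legs and the degrees at a fixed block `y` -/

/-- **Step 2 — distributivity** (as (44) ⇒ (45)): at fixed `(j, y, n)`, summing (57) over the admissible legs gives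
`Σ_{c₁,…,c_n} |w_{(y,c)}(b)| ≤ C g^m s(y)ⁿ exp(−½δ₀𝓛({b_i} ∪ {y}))`, `s(y) = Σ_c leg(c)` (Mathlib `Finset.sum_pow'`).
[cite: Balaban1985UV3, (57) p.270] -/
theorem degreeSum57_le (adm : Finset X.Bond) (w : (n : ℕ) → (Fin n → X.Bond) → CoeffSizes X)
    {gk κ₁ δ₀ M₁ ℓ C C' : ℝ} (y : X.Site) (n : ℕ)
    (h57 : ∀ c ∈ Fintype.piFinset (fun _ : Fin n => adm), Bound57 X (w n c) gk κ₁ δ₀ M₁ ℓ C C' y c)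
    (m : ℕ) (b : Fin m → X.Bond) :
    ∑ c ∈ Fintype.piFinset (fun _ : Fin n => adm), |w n c m b| ≤
      C * gk ^ m * (∑ c ∈ adm, leg57 X κ₁ M₁ ℓ C' y c) ^ n *
        Real.exp (-(δ₀ / 2) * X.treeLen (Set.range b) {y}) := by
  classical
  rw [Finset.sum_pow', mul_sum, sum_mul]
  refine sum_le_sum (fun c hc => ?_)
  have h := (bound57_iff_leg (w n c) gk κ₁ δ₀ M₁ ℓ C C' y c).1 (h57 c hc) m b
  simpa [mul_assoc, mul_comm, mul_left_comm] using h

/-- **Step 3b — one degree**: for `n ≥ 2`, `0 ≤ s ≤ S₀ℓ²` and `0 ≤ ℓ ≤ 1`, `sⁿ ≤ S₀ⁿ·ℓ⁴` (*"Because n ≥ 2, so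
L^{−2n} ≤ L^{−4}"*, p. 267). [cite: Balaban1985UV3, p.267 (after (46))] -/
theorem legSum_pow_le {s S₀ ℓ : ℝ} {n : ℕ} (hs0 : 0 ≤ s) (hs : s ≤ S₀ * ℓ ^ 2) (hS₀ : 0 ≤ S₀) (hℓ0 : 0 ≤ ℓ)
    (hℓ1 : ℓ ≤ 1) (hn : 2 ≤ n) : s ^ n ≤ S₀ ^ n * ℓ ^ 4 := by
  have hℓ2 : ℓ ^ 2 ≤ 1 := pow_le_one₀ hℓ0 hℓ1
  have hℓ2n : (ℓ ^ 2) ^ n ≤ (ℓ ^ 2) ^ 2 := pow_le_pow_of_le_one (sq_nonneg ℓ) hℓ2 hn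
  calc s ^ n ≤ (S₀ * ℓ ^ 2) ^ n := pow_le_pow_left₀ hs0 hs n
    _ = S₀ ^ n * (ℓ ^ 2) ^ n := mul_pow _ _ _
    _ ≤ S₀ ^ n * (ℓ ^ 2) ^ 2 := mul_le_mul_of_nonneg_left hℓ2n (pow_nonneg hS₀ n)
    _ = S₀ ^ n * ℓ ^ 4 := by ring

/-- **Steps 2–3 at a fixed block** `y` of scale `j`: with (57) for every term `(y, c)`, the degree floor `n ≥ 2` of (43)
(`w n c = 0` for `n < 2`), `0 ≤ s(y) ≤ S₀ℓ²`, `0 ≤ ℓ ≤ 1`, `S₀ ≥ 0`: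
`Σ_{n≤N} Σ_{c} |w_{(y,c)}(b)| ≤ C g^m ℓ⁴ (Σ_{2≤n≤N} S₀ⁿ) exp(−½δ₀𝓛({b_i} ∪ {y}))`. [cite: Balaban1985UV3, (57) p.270] -/
theorem nSum57_le (adm : Finset X.Bond) (w : (n : ℕ) → (Fin n → X.Bond) → CoeffSizes X) (N : ℕ)
    {gk κ₁ δ₀ M₁ ℓ C C' S₀ : ℝ} (hC : 0 ≤ C) (hg : 0 ≤ gk) (hS₀ : 0 ≤ S₀) (hℓ0 : 0 ≤ ℓ) (hℓ1 : ℓ ≤ 1) (y : X.Site)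
    (h57 : ∀ (n : ℕ), ∀ c ∈ Fintype.piFinset (fun _ : Fin n => adm), Bound57 X (w n c) gk κ₁ δ₀ M₁ ℓ C C' y c)
    (hfloor : ∀ (n : ℕ) (c : Fin n → X.Bond), n < 2 → w n c = 0)
    (hs0 : 0 ≤ ∑ c ∈ adm, leg57 X κ₁ M₁ ℓ C' y c) (hs : ∑ c ∈ adm, leg57 X κ₁ M₁ ℓ C' y c ≤ S₀ * ℓ ^ 2)
    (m : ℕ) (b : Fin m → X.Bond) :
    ∑ n ∈ range (N + 1), ∑ c ∈ Fintype.piFinset (fun _ : Fin n => adm), |w n c m b| ≤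
      C * gk ^ m * ℓ ^ 4 * geomTail S₀ N * Real.exp (-(δ₀ / 2) * X.treeLen (Set.range b) {y}) := by
  classical
  set s := ∑ c ∈ adm, leg57 X κ₁ M₁ ℓ C' y c with hs_def
  set E := Real.exp (-(δ₀ / 2) * X.treeLen (Set.range b) {y}) with hE_def
  have hE : 0 ≤ E := (Real.exp_pos _).le
  have hzero : ∀ n, n < 2 → ∑ c ∈ Fintype.piFinset (fun _ : Fin n => adm), |w n c m b| = 0 := by
    intro n hn
    exact sum_eq_zero (fun c _ => by rw [hfloor n c hn]; simp)
  have hdeg : ∀ n ∈ Ico 2 (N + 1), ∑ c ∈ Fintype.piFinset (fun _ : Fin n => adm), |w n c m b|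
      ≤ C * gk ^ m * ℓ ^ 4 * S₀ ^ n * E := by
    intro n hn
    have hn2 : 2 ≤ n := (mem_Ico.1 hn).1
    calc ∑ c ∈ Fintype.piFinset (fun _ : Fin n => adm), |w n c m b|
        ≤ C * gk ^ m * s ^ n * E := degreeSum57_le adm w y n (h57 n) m b
      _ ≤ C * gk ^ m * (S₀ ^ n * ℓ ^ 4) * E := by
          have := legSum_pow_le hs0 hs hS₀ hℓ0 hℓ1 hn2
          have hCg : 0 ≤ C * gk ^ m := mul_nonneg hC (pow_nonneg hg m)
          exact mul_le_mul_of_nonneg_right (mul_le_mul_of_nonneg_left this hCg) hE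
      _ = C * gk ^ m * ℓ ^ 4 * S₀ ^ n * E := by ring
  rcases Nat.lt_or_ge N 1 with hN | hN
  · have hN0 : N = 0 := by omega
    subst hN0
    rw [sum_range_one, hzero 0 (by omega)]
    have : 0 ≤ geomTail S₀ 0 := sum_nonneg (fun n _ => pow_nonneg hS₀ n)
    positivity
  · rw [range_eq_Ico, ← sum_Ico_consecutive _ (by omega : 0 ≤ 2) (by omega : 2 ≤ N + 1)]
    have h01 : ∑ n ∈ Ico 0 2, ∑ c ∈ Fintype.piFinset (fun _ : Fin n => adm), |w n c m b| = 0 :=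
      sum_eq_zero (fun n hn => hzero n (mem_Ico.1 hn).2)
    rw [h01, zero_add]
    calc ∑ n ∈ Ico 2 (N + 1), ∑ c ∈ Fintype.piFinset (fun _ : Fin n => adm), |w n c m b|
        ≤ ∑ n ∈ Ico 2 (N + 1), C * gk ^ m * ℓ ^ 4 * S₀ ^ n * E := sum_le_sum hdeg
      _ = C * gk ^ m * ℓ ^ 4 * geomTail S₀ N * E := by
          rw [geomTail, mul_sum, sum_mul]

/-! ## §3 Step 4: the tree-decay factor splits off the monomial part -/

/-- **Step 4 — tree geometry**: if `𝓛({b_i} ∪ {y}) ≥ 𝓛({b_i})` and `𝓛({b_i} ∪ {y}) ≥ |b_{i₀,−} − y|` for a point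
`b_{i₀,−}` of the monomial (a shortest connected graph through the points of the `b_i` and `y` is at least as long as
one through the `b_i` alone, and at least as long as the distance between two of its points), then for `δ₀ ≥ 0`
`exp(−½δ₀𝓛({b_i} ∪ {y})) ≤ exp(−¼δ₀𝓛({b_i}))·exp(−¼δ₀|b_{i₀,−} − y|)`. [cite: Balaban1985UV3, (57) p.270, p.270 (𝓛)] -/
theorem treeFactor_split {δ₀ : ℝ} (hδ : 0 ≤ δ₀) {m : ℕ} (b : Fin m → X.Bond) (i : Fin m) (y : X.Site)
    (hmono : X.treeLen (Set.range b) ∅ ≤ X.treeLen (Set.range b) {y})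
    (hfar : X.dist (X.cminus (b i)) y ≤ X.treeLen (Set.range b) {y}) :
    Real.exp (-(δ₀ / 2) * X.treeLen (Set.range b) {y}) ≤
      Real.exp (-(δ₀ / 4) * X.treeLen (Set.range b) ∅) * Real.exp (-(δ₀ / 4) * X.dist (X.cminus (b i)) y) := by
  rw [← Real.exp_add]
  apply Real.exp_le_exp.2
  nlinarith

/-! ## §4 Steps 5–6: the sums over the blocks `y` and over the scales `j` -/

/-- **Step 5 — the block sum at scale j** (*"Summation over y gives the factor (M₁L^jη)^{−3}"*, p. 267, here weighted
by the split-off decay): with steps 2–4 and `Σ_{y ∈ blocks} exp(−¼δ₀|x − y|) ≤ K(M₁ℓ)^{−3}` for every site `x`,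
`Σ_y Σ_{n≤N} Σ_c |w_{(y,c)}(b)| ≤ C g^m ℓ⁴ G · exp(−¼δ₀𝓛({b_i})) · K(M₁ℓ)^{−3}` (`m ≥ 1`). [cite: Balaban1985UV3, (45)–(46) p.267, (57) p.270] -/
theorem blockSum57_le (blocks : Finset X.Site) (adm : X.Site → Finset X.Bond)
    (w : X.Site → (n : ℕ) → (Fin n → X.Bond) → CoeffSizes X) (N : ℕ)
    {gk κ₁ δ₀ M₁ ℓ C C' S₀ K : ℝ} (hC : 0 ≤ C) (hC' : 0 ≤ C') (hg : 0 ≤ gk) (hδ : 0 ≤ δ₀) (hS₀ : 0 ≤ S₀)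
    (hℓ0 : 0 ≤ ℓ) (hℓ1 : ℓ ≤ 1) (hdist : ∀ x y, 0 ≤ X.dist x y)
    (h57 : ∀ y ∈ blocks, ∀ (n : ℕ), ∀ c ∈ Fintype.piFinset (fun _ : Fin n => adm y),
      Bound57 X (w y n c) gk κ₁ δ₀ M₁ ℓ C C' y c)
    (hfloor : ∀ (y : X.Site) (n : ℕ) (c : Fin n → X.Bond), n < 2 → w y n c = 0)
    (hs : ∀ y ∈ blocks, ∑ c ∈ adm y, leg57 X κ₁ M₁ ℓ C' y c ≤ S₀ * ℓ ^ 2)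
    (hmono : ∀ (m : ℕ) (b : Fin m → X.Bond) (y : X.Site), X.treeLen (Set.range b) ∅ ≤ X.treeLen (Set.range b) {y})
    (hfar : ∀ (m : ℕ) (b : Fin m → X.Bond) (i : Fin m) (y : X.Site),
      X.dist (X.cminus (b i)) y ≤ X.treeLen (Set.range b) {y})
    (hK : ∀ x : X.Site, ∑ y ∈ blocks, Real.exp (-(δ₀ / 4) * X.dist x y) ≤ K * (M₁ * ℓ)⁻¹ ^ 3)
    {m : ℕ} (b : Fin m → X.Bond) (i : Fin m) :
    ∑ y ∈ blocks, ∑ n ∈ range (N + 1), ∑ c ∈ Fintype.piFinset (fun _ : Fin n => adm y), |w y n c m b| ≤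
      C * gk ^ m * ℓ ^ 4 * geomTail S₀ N * Real.exp (-(δ₀ / 4) * X.treeLen (Set.range b) ∅) *
        (K * (M₁ * ℓ)⁻¹ ^ 3) := by
  have hG : 0 ≤ geomTail S₀ N := sum_nonneg (fun n _ => pow_nonneg hS₀ n)
  have hA : 0 ≤ C * gk ^ m * ℓ ^ 4 * geomTail S₀ N := by positivity
  have hper : ∀ y ∈ blocks, ∑ n ∈ range (N + 1), ∑ c ∈ Fintype.piFinset (fun _ : Fin n => adm y), |w y n c m b|
      ≤ C * gk ^ m * ℓ ^ 4 * geomTail S₀ N *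
          (Real.exp (-(δ₀ / 4) * X.treeLen (Set.range b) ∅) * Real.exp (-(δ₀ / 4) * X.dist (X.cminus (b i)) y)) := by
    intro y hy
    have hs0 : 0 ≤ ∑ c ∈ adm y, leg57 X κ₁ M₁ ℓ C' y c :=
      sum_nonneg (fun c _ => leg57_nonneg hC' hℓ0 hdist y c)
    calc _ ≤ C * gk ^ m * ℓ ^ 4 * geomTail S₀ N * Real.exp (-(δ₀ / 2) * X.treeLen (Set.range b) {y}) :=
          nSum57_le (adm y) (w y) N hC hg hS₀ hℓ0 hℓ1 y (h57 y hy) (hfloor y) hs0 (hs y hy) m b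
      _ ≤ _ := mul_le_mul_of_nonneg_left (treeFactor_split hδ b i y (hmono m b y) (hfar m b i y)) hA
  calc _ ≤ ∑ y ∈ blocks, C * gk ^ m * ℓ ^ 4 * geomTail S₀ N *
          (Real.exp (-(δ₀ / 4) * X.treeLen (Set.range b) ∅) * Real.exp (-(δ₀ / 4) * X.dist (X.cminus (b i)) y)) :=
        sum_le_sum hper
    _ = C * gk ^ m * ℓ ^ 4 * geomTail S₀ N * Real.exp (-(δ₀ / 4) * X.treeLen (Set.range b) ∅) *
          ∑ y ∈ blocks, Real.exp (-(δ₀ / 4) * X.dist (X.cminus (b i)) y) := by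
        rw [mul_sum]
        exact sum_congr rfl (fun y _ => by ring)
    _ ≤ _ := mul_le_mul_of_nonneg_left (hK _) (mul_nonneg hA (Real.exp_pos _).le)

/-- Re-indexing of the scale sum: `Σ_{j=1}^{k} q^{k−j} = Σ_{m<k} q^m`. [cite: Balaban1985UV3, (46) p.267] -/
private theorem sum_Icc_pow_sub_eq (q : ℝ) (k : ℕ) :
    ∑ j ∈ Icc 1 k, q ^ (k - j) = ∑ m ∈ range k, q ^ m := by
  refine sum_nbij' (fun j => k - j) (fun m => k - m) ?_ ?_ ?_ ?_ ?_
  · intro j hj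
    simp only [mem_Icc] at hj
    simp only [mem_range]
    omega
  · intro m hm
    simp only [mem_range] at hm
    simp only [mem_Icc]
    omega
  · intro j hj
    simp only [mem_Icc] at hj
    omega
  · intro m hm
    simp only [mem_range] at hm
    omega
  · intro j _
    rfl

/-- **Step 6 — the scale sum is the d = 3 power counting**: with `ℓ_j = L^{j−k}` (`j = 1, …, k`, `L > 1`),
`Σ_j ℓ_j⁴·(M₁ℓ_j)^{−3} = M₁^{−3} Σ_j L^{j−k} ≤ M₁^{−3}·L/(L − 1)` (`B10.powerCounting_d3`; p. 267 *"finally summation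
over j = 1, …, k"*). [cite: Balaban1985UV3, (46) p.267] -/
theorem scaleSum_le (k : ℕ) (ℓ : ℕ → ℝ) {L M₁ : ℝ} (hL : 1 < L) (hM : 0 < M₁)
    (hℓ : ∀ j ∈ Icc 1 k, ℓ j = L⁻¹ ^ (k - j)) :
    ∑ j ∈ Icc 1 k, ℓ j ^ 4 * (M₁ * ℓ j)⁻¹ ^ 3 ≤ M₁⁻¹ ^ 3 * (L / (L - 1)) := by
  have hℓpos : ∀ j ∈ Icc 1 k, 0 < ℓ j := fun j hj => by
    rw [hℓ j hj]; exact pow_pos (inv_pos.2 (by linarith)) _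
  have hterm : ∀ j ∈ Icc 1 k, ℓ j ^ 4 * (M₁ * ℓ j)⁻¹ ^ 3 = M₁⁻¹ ^ 3 * ℓ j := by
    intro j hj
    have h0 : ℓ j ≠ 0 := (hℓpos j hj).ne'
    field_simp
  rw [sum_congr rfl hterm, ← mul_sum]
  have hscale : ∑ j ∈ Icc 1 k, ℓ j ≤ L / (L - 1) := by
    calc ∑ j ∈ Icc 1 k, ℓ j = ∑ j ∈ Icc 1 k, L⁻¹ ^ (k - j) := sum_congr rfl hℓ
      _ = ∑ m ∈ range k, L⁻¹ ^ m := sum_Icc_pow_sub_eq L⁻¹ k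
      _ ≤ L / (L - 1) := by simpa using B10.powerCounting_d3 L hL k
  exact mul_le_mul_of_nonneg_left hscale (pow_nonneg (inv_nonneg.2 hM.le) 3)

/-! ## §5 The resummation theorem: (57) for every term ⇒ (56)-shape for the resummed coefficients -/

/-- Degree `0` is empty: the A-independent parts `𝒫_j(Y_j, U_{k+1})` of the expansions are kept OUTSIDE the
fluctuation integral by (58), so the resummed polynomial `𝒱(A)` has no constant term. [cite: Balaban1985UV3, (58) p.270] -/
theorem resum_zero (k N : ℕ) (blocks : ℕ → Finset X.Site) (adm : ℕ → X.Site → Finset X.Bond)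
    (w : ℕ → X.Site → (n : ℕ) → (Fin n → X.Bond) → CoeffSizes X)
    (hm0 : ∀ (j : ℕ) (y : X.Site) (n : ℕ) (c : Fin n → X.Bond) (b : Fin 0 → X.Bond), w j y n c 0 b = 0)
    (b : Fin 0 → X.Bond) : resum X k N blocks adm w 0 b = 0 := by
  unfold resum
  exact sum_eq_zero (fun j _ => sum_eq_zero (fun y _ => sum_eq_zero (fun n _ =>
    sum_eq_zero (fun c _ => hm0 j y n c b))))

/-- **(57) ⇒ (56) for the resummed coefficients** — p. 270 *"We sum up all the coefficients at the same monomial in A.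
We get a coefficient which, by bound similar to (45), (46), can be estimated as in (56) (with O(g_k^m))."*, made a
theorem with explicit constants.  DATA: scales `j = 1, …, k` with `ℓ_j = L^jη = L^{j−k}`; blocks `blocks j` (sites `y`
of the `M₁L^jη`-lattice); admissible legs `adm j y` ((43)); degree cut-off `N`; coefficient families `w j y n c`.
HYPOTHESES: (57) for every previous-scale term `Y_j = (y, c)`, constants `C, C′ ≥ 0`, `g_k ≥ 0`, `δ₀ ≥ 0`; the degree
floor `n ≥ 2` of (43); no degree-0 coefficients ((58)); the two properties of the printed tree length `𝓛` of step 4;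
the one-leg lattice-sum bound `Z ≥ 0` (step 3) and the block-sum bound `K ≥ 0` (step 5) — print's *"similar to
(45), (46)"*; `L > 1`, `M₁ > 0`, distances `≥ 0`.  CONCLUSION: `Bound56Resummed X (resum …) g_k (δ₀/2) C⋆`, i.e.
**`|W(g_k, b₁, …, b_m)| ≤ C⋆·g_k^m·exp(−¼δ₀𝓛({b_i}))`** for every monomial, with
`C⋆ = C·(Σ_{2≤n≤N}(C′Z)ⁿ)·K·M₁^{−3}·L/(L − 1)` — the shape of (56) *"with O(g_k^m)"* at HALF the tree-decay rate of (57).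
Certified bookkeeping; no content of the series. [cite: Balaban1985UV3, p.270 (after (57))] -/
theorem bound56Resummed_of_bound57 (k N : ℕ) (blocks : ℕ → Finset X.Site) (adm : ℕ → X.Site → Finset X.Bond)
    (w : ℕ → X.Site → (n : ℕ) → (Fin n → X.Bond) → CoeffSizes X) (ℓ : ℕ → ℝ)
    {L M₁ κ₁ δ₀ gk C C' Z K : ℝ} (hL : 1 < L) (hM : 0 < M₁) (hδ : 0 ≤ δ₀) (hg : 0 ≤ gk) (hC : 0 ≤ C)
    (hC' : 0 ≤ C') (hZ0 : 0 ≤ Z) (hK0 : 0 ≤ K) (hdist : ∀ x y, 0 ≤ X.dist x y)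
    (hℓ : ∀ j ∈ Icc 1 k, ℓ j = L⁻¹ ^ (k - j))
    (h57 : ∀ j ∈ Icc 1 k, ∀ y ∈ blocks j, ∀ (n : ℕ), ∀ c ∈ Fintype.piFinset (fun _ : Fin n => adm j y),
      Bound57 X (w j y n c) gk κ₁ δ₀ M₁ (ℓ j) C C' y c)
    (hfloor : ∀ (j : ℕ) (y : X.Site) (n : ℕ) (c : Fin n → X.Bond), n < 2 → w j y n c = 0)
    (hm0 : ∀ (j : ℕ) (y : X.Site) (n : ℕ) (c : Fin n → X.Bond) (b : Fin 0 → X.Bond), w j y n c 0 b = 0)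
    (hmono : ∀ (m : ℕ) (b : Fin m → X.Bond) (y : X.Site), X.treeLen (Set.range b) ∅ ≤ X.treeLen (Set.range b) {y})
    (hfar : ∀ (m : ℕ) (b : Fin m → X.Bond) (i : Fin m) (y : X.Site),
      X.dist (X.cminus (b i)) y ≤ X.treeLen (Set.range b) {y})
    (hZ : ∀ j ∈ Icc 1 k, ∀ y ∈ blocks j, ∑ c ∈ adm j y,
      Real.exp (-(κ₁ / 2) * (M₁ * ℓ j)⁻¹ * X.dist (X.cminus c) y) * ((ℓ j)⁻¹ * X.dist (X.cminus c) y) ≤ Z)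
    (hK : ∀ j ∈ Icc 1 k, ∀ x : X.Site,
      ∑ y ∈ blocks j, Real.exp (-(δ₀ / 4) * X.dist x y) ≤ K * (M₁ * ℓ j)⁻¹ ^ 3) :
    Bound56Resummed X (resum X k N blocks adm w) gk (δ₀ / 2)
      (C * geomTail (C' * Z) N * K * M₁⁻¹ ^ 3 * (L / (L - 1))) := by
  intro m b
  have hrate : -(δ₀ / 2 / 2) = -(δ₀ / 4) := by ring
  rw [hrate]
  have hS₀ : 0 ≤ C' * Z := mul_nonneg hC' hZ0
  have hG : 0 ≤ geomTail (C' * Z) N := sum_nonneg (fun n _ => pow_nonneg hS₀ n)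
  have hL1 : 0 ≤ L / (L - 1) := div_nonneg (by linarith) (by linarith)
  have hCst : 0 ≤ C * geomTail (C' * Z) N * K * M₁⁻¹ ^ 3 * (L / (L - 1)) := by
    have := inv_nonneg.2 hM.le
    positivity
  rcases Nat.eq_zero_or_pos m with hm | hm
  · -- degree 0: the resummed family vanishes there
    subst hm
    rw [resum_zero k N blocks adm w hm0 b, abs_zero]
    positivity
  · -- degree ≥ 1: steps 1–6 with the point b_{0,−} of the monomial
    set i : Fin m := ⟨0, hm⟩ with hi
    have hℓ01 : ∀ j ∈ Icc 1 k, 0 ≤ ℓ j ∧ ℓ j ≤ 1 := by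
      intro j hj
      rw [hℓ j hj]
      have h0 : 0 ≤ L⁻¹ := inv_nonneg.2 (by linarith)
      have h1 : L⁻¹ ≤ 1 := inv_le_one_of_one_le₀ hL.le
      exact ⟨pow_nonneg h0 _, pow_le_one₀ h0 h1⟩
    -- per scale j
    have hscale : ∀ j ∈ Icc 1 k,
        ∑ y ∈ blocks j, ∑ n ∈ range (N + 1), ∑ c ∈ Fintype.piFinset (fun _ : Fin n => adm j y), |w j y n c m b|
          ≤ C * gk ^ m * ℓ j ^ 4 * geomTail (C' * Z) N * Real.exp (-(δ₀ / 4) * X.treeLen (Set.range b) ∅) *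
              (K * (M₁ * ℓ j)⁻¹ ^ 3) := by
      intro j hj
      obtain ⟨hℓ0, hℓ1⟩ := hℓ01 j hj
      refine blockSum57_le (blocks j) (adm j) (w j) N hC hC' hg hδ hS₀ hℓ0 hℓ1 hdist (h57 j hj) (hfloor j)
        (fun y hy => sum_leg57_le hC' (adm j y) y (hZ j hj y hy)) hmono hfar (hK j hj) b i
    -- |W| ≤ Σ_j Σ_y Σ_n Σ_c |w|
    have habs : |resum X k N blocks adm w m b| ≤ ∑ j ∈ Icc 1 k, ∑ y ∈ blocks j, ∑ n ∈ range (N + 1),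
        ∑ c ∈ Fintype.piFinset (fun _ : Fin n => adm j y), |w j y n c m b| := by
      unfold resum
      refine (abs_sum_le_sum_abs _ _).trans (sum_le_sum (fun j _ => ?_))
      refine (abs_sum_le_sum_abs _ _).trans (sum_le_sum (fun y _ => ?_))
      refine (abs_sum_le_sum_abs _ _).trans (sum_le_sum (fun n _ => ?_))
      exact abs_sum_le_sum_abs _ _
    refine habs.trans ?_
    calc ∑ j ∈ Icc 1 k, ∑ y ∈ blocks j, ∑ n ∈ range (N + 1),
          ∑ c ∈ Fintype.piFinset (fun _ : Fin n => adm j y), |w j y n c m b|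
        ≤ ∑ j ∈ Icc 1 k, C * gk ^ m * ℓ j ^ 4 * geomTail (C' * Z) N *
            Real.exp (-(δ₀ / 4) * X.treeLen (Set.range b) ∅) * (K * (M₁ * ℓ j)⁻¹ ^ 3) := sum_le_sum hscale
      _ = C * gk ^ m * geomTail (C' * Z) N * K * Real.exp (-(δ₀ / 4) * X.treeLen (Set.range b) ∅) *
            ∑ j ∈ Icc 1 k, ℓ j ^ 4 * (M₁ * ℓ j)⁻¹ ^ 3 := by
          rw [mul_sum]
          exact sum_congr rfl (fun j _ => by ring)
      _ ≤ C * gk ^ m * geomTail (C' * Z) N * K * Real.exp (-(δ₀ / 4) * X.treeLen (Set.range b) ∅) *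
            (M₁⁻¹ ^ 3 * (L / (L - 1))) := by
          apply mul_le_mul_of_nonneg_left (scaleSum_le k ℓ hL hM hℓ)
          have : 0 ≤ gk ^ m := pow_nonneg hg m
          positivity
      _ = C * geomTail (C' * Z) N * K * M₁⁻¹ ^ 3 * (L / (L - 1)) * gk ^ m *
            Real.exp (-(δ₀ / 4) * X.treeLen (Set.range b) ∅) := by ring

/-- The conclusion in the printed words: the resummed coefficients obey the bound of (56) *"with O(g_k^m)"* —
`|W(g_k, b₁, …, b_m)| ≤ O(1)·g_k^m·exp(−¼δ₀𝓛({b_i}))`, `O(1) = C⋆` explicit (unfolding of `Bound56Resummed` at the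
halved rate). [cite: Balaban1985UV3, (56) p.269, p.270 (after (57))] -/
theorem resum_bound_printed_shape (W : CoeffSizes X) {gk δ₀ Cstar : ℝ}
    (h : Bound56Resummed X W gk (δ₀ / 2) Cstar) (m : ℕ) (b : Fin m → X.Bond) :
    |W m b| ≤ Cstar * gk ^ m * Real.exp (-(δ₀ / 4) * X.treeLen (Set.range b) ∅) := by
  have := h m b
  have hrate : -(δ₀ / 2 / 2) = -(δ₀ / 4) := by ring
  rwa [hrate] at this

end Literature.MathematicalPhysics.QuantumFieldTheory.Balaban1983to89.B10Eq57Resummation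

end
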